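import Summits.QuantumAdvantage.QuantumAdvantage.Theorems.GaussRankPolyImpliesPPoly.Negative.QuadraticRelations
import Summits.QuantumAdvantage.QuantumAdvantage.Theorems.GaussRankPolyImpliesPPoly.Negative.CornerLemma

/-!
# Negative lemmas III-e: the Gaussian fidelity of `|M⟩^{⊗t}` is `≤ 2^{-t}`; the poly-coefficient strengthening of `X` is false

Disprover's support file for crux `SpinorFlattening.GaussRankPolyImpliesPPoly` (stmt-QuantumAdvantage-1247),
refuter-cdisprove-stmt-QuantumAdvantage-1247-g2-0 (gen 2, 2026-08-16); work file `Cruxes/GaussRankPolyImpliesPPoly/Disproof.lean`.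
Part of the in-tree proof of the Gaussian fidelity bound `F_𝒢(M^{⊗t}) ≤ 2^{-t}` (CudbyStrelchuk2023 Lemma 3)
from the annihilator definition `IsGaussian` (files MajoranaAction → MajoranaCAR → QuadraticRelations →
CornerLemma → GaussianFidelity). Sorry-free; nothing here asserts a Theses statement.

THIS FILE: transport along `(t+1)*4 = t*4+4` (`quadRel_reindex`, `normSq_reindex`, `dotProduct_reindex`),
`⟨ψ ⊗ M, G⟩ = (√2)⁻¹(⟨ψ, G(·,0000)⟩ + ⟨ψ, G(·,1111)⟩)` (`star_tensorVec_magicM_dotProduct`), the induction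
`magicMPow_overlap_le` (`|⟨M^{⊗t}, G⟩| ≤ 2^{-t/2}‖G‖` for all `G` with the quadratic relations — inherited by the
corner conditionals, closed by the corner lemma), `magicPowFidelityBound_holds` (`|⟨M^{⊗t}, g⟩|² ≤ 2^{-t}‖g‖²`
for Gaussian `g`: CudbyStrelchuk2023 Lemma 3, new proof) and `not_polyCoeffThesis`: the natural strengthening
of the route's target `X` with UNIT Gaussian terms and coefficients `‖aᵢ‖ ≤ t^c + c` is FALSE, unconditionally
(discharging the hypothesis of `not_polyCoeffThesis_of_fidelityBound`), and the sharp one-term bound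
`normSq_magicMPow_sub_smul_gaussian_ge`: `‖M^{⊗t} − a·g‖² ≥ 1 − 2^{-t}` for every Gaussian `g` and scalar `a`
(the `r = 1` case of the kill item at every constant `δ`).
-/

set_option linter.dupNamespace false

noncomputable section

namespace Summit.QuantumAdvantage.QuantumAdvantage.Theorems.GaussRankPolyImpliesPPoly.Negative

open Literature.Computability.Cryptography Literature.Computability.QuantumComplexity
open Matrix

/-- Transport of `QuadRel` along an equality of wire counts. [folklore] -/
theorem quadRel_reindex {n n' : ℕ} (h : n = n') {G : QReg n → ℂ}
    (hG : (∀ u v : QReg n, ∑ p : Fin n × Bool, (majorana n p.1 p.2 *ᵥ G) u * (majorana n p.1 p.2 *ᵥ G) v = 0)) :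
    (∀ u v : QReg n', ∑ p : Fin n' × Bool, (majorana n' p.1 p.2 *ᵥ (fun y : QReg n' => G (fun i => y (Fin.cast h i)))) u * (majorana n' p.1 p.2 *ᵥ (fun y : QReg n' => G (fun i => y (Fin.cast h i)))) v = 0) := by
  subst h
  exact hG

/-- Transport of `normSq` along an equality of wire counts. [folklore] -/
theorem normSq_reindex {n n' : ℕ} (h : n = n') (G : QReg n → ℂ) :
    normSq (fun y : QReg n' => G (fun i => y (Fin.cast h i))) = normSq G := by
  subst h
  rfl

/-- Transport of the overlap along an equality of wire counts. [folklore] -/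
theorem dotProduct_reindex {n n' : ℕ} (h : n = n') (ψ G : QReg n → ℂ) :
    star (fun y : QReg n' => ψ (fun i => y (Fin.cast h i))) ⬝ᵥ (fun y : QReg n' => G (fun i => y (Fin.cast h i))) =
      star ψ ⬝ᵥ G := by
  subst h
  rfl

/-- The overlap with a tensor product with `|M⟩` on the last block:
`⟨ψ ⊗ M, G⟩ = (√2)⁻¹ (⟨ψ, G(·,0000)⟩ + ⟨ψ, G(·,1111)⟩)`. [folklore] -/
theorem star_tensorVec_magicM_dotProduct {b : ℕ} (ψ : QReg b → ℂ) (G : QReg (b + 4) → ℂ) :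
    star (tensorVec ψ magicM) ⬝ᵥ G =
      ((Real.sqrt 2 : ℂ)⁻¹) * (star ψ ⬝ᵥ cond4 G s0000 + star ψ ⬝ᵥ cond4 G s1111) := by
  classical
  unfold dotProduct
  simp only [Pi.star_apply]
  rw [← Fintype.sum_equiv (Fin.appendEquiv b 4) (fun p => star (tensorVec ψ magicM (Fin.append p.1 p.2)) *
      G (Fin.append p.1 p.2)) (fun z => star (tensorVec ψ magicM z) * G z) (fun p => rfl),
    Fintype.sum_prod_type, Finset.sum_comm]
  have htv : ∀ (w : QReg b) (x : QReg 4), tensorVec ψ magicM (Fin.append w x) = ψ w * magicM x := by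
    intro w x
    unfold tensorVec
    congr 1
    · congr 1; funext i; exact Fin.append_left w x i
    · congr 1; funext j; exact Fin.append_right w x j
  simp_rw [htv]
  have hM : ∀ x : QReg 4, magicM x = if (x = s0000 ∨ x = s1111) then ((Real.sqrt 2 : ℂ)⁻¹) else 0 := by
    intro x
    rw [magicM_apply]
    by_cases h : x = s0000 ∨ x = s1111
    · rw [if_pos h]
      rcases h with rfl | rfl <;> simp [s0000, s1111]
    · rw [if_neg h, if_neg]
      intro hall
      apply h
      cases hx : x 0
      · left; funext i; rw [hall i, hx]; rfl
      · right; funext i; rw [hall i, hx]; rfl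
  have hne : s0000 ≠ s1111 := by decide
  rw [Finset.sum_eq_add s0000 s1111 hne]
  · have h0 : magicM s0000 = ((Real.sqrt 2 : ℂ)⁻¹) := by rw [hM, if_pos (Or.inl rfl)]
    have h1 : magicM s1111 = ((Real.sqrt 2 : ℂ)⁻¹) := by rw [hM, if_pos (Or.inr rfl)]
    simp_rw [h0, h1]
    have hr : star ((Real.sqrt 2 : ℂ)⁻¹) = ((Real.sqrt 2 : ℂ)⁻¹) := by
      rw [Complex.star_def, map_inv₀, Complex.conj_ofReal]
    unfold cond4
    rw [mul_add, Finset.mul_sum, Finset.mul_sum]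
    congr 1 <;> refine Finset.sum_congr rfl fun w _ => ?_ <;> rw [star_mul', hr] <;> ring
  · intro x _ hx
    have : magicM x = 0 := by rw [hM, if_neg (not_or.2 ⟨hx.1, hx.2⟩)]
    simp [this]
  · simp
  · simp

/-- **GAUSSIAN FIDELITY OF `|M⟩^{⊗t}` FOR QUADREL VECTORS**: `|⟨M^{⊗t}, G⟩| ≤ 2^{-t/2} ‖G‖` for every `G`
satisfying the quadratic relations (induction on `t`: peel the last block with
`star_tensorVec_magicM_dotProduct`, apply the hypothesis to the two corner conditionals — which inherit
`QuadRel` — and close with the corner lemma). [cite: CudbyStrelchuk2023, Lemma 3] -/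
theorem magicMPow_overlap_le (t : ℕ) : ∀ (G : QReg (t * 4) → ℂ),
    (∀ u v : QReg (t * 4), ∑ p : Fin (t * 4) × Bool, (majorana (t * 4) p.1 p.2 *ᵥ G) u * (majorana (t * 4) p.1 p.2 *ᵥ G) v = 0) →
    ‖star (magicMPow t) ⬝ᵥ G‖ ≤ ((Real.sqrt 2)⁻¹) ^ t * Real.sqrt (normSq G) := by
  induction t with
  | zero =>
    intro G _
    rw [magicMPow_zero, pow_zero, one_mul]
    have huniv : (Finset.univ : Finset (QReg (0 * 4))) = {fun i => i.elim0} := by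
      ext x; simp only [Finset.mem_univ, Finset.mem_singleton, true_iff]; funext i; exact i.elim0
    unfold dotProduct normSq
    rw [huniv, Finset.sum_singleton, Finset.sum_singleton, Real.sqrt_sq (norm_nonneg _)]
    simp
  | succ t ih =>
    intro G hG
    have h : (t + 1) * 4 = t * 4 + 4 := add_one_mul t 4
    -- transport to `t * 4 + 4` wires
    set G' : QReg (t * 4 + 4) → ℂ := fun y => G (fun i => y (Fin.cast h i)) with hG'
    have hq' := quadRel_reindex h hG
    have hn' : normSq G' = normSq G := normSq_reindex h G
    have hov : star (magicMPow (t + 1)) ⬝ᵥ G = star (tensorVec (magicMPow t) magicM) ⬝ᵥ G' := by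
      have e : magicMPow (t + 1) = fun y : QReg ((t + 1) * 4) =>
          (tensorVec (magicMPow t) magicM) (fun i => y (Fin.cast h.symm i)) := by
        funext y
        rw [magicMPow_succ]
      have eG : G = fun y : QReg ((t + 1) * 4) => G' (fun i => y (Fin.cast h.symm i)) := by
        funext y
        rfl
      rw [e, eG]
      exact dotProduct_reindex h.symm (tensorVec (magicMPow t) magicM) G'
    rw [hov, star_tensorVec_magicM_dotProduct, ← hn']
    have ha := ih (cond4 G' s0000) (quadRel_cond4 hq' s0000)
    have hb := ih (cond4 G' s1111) (quadRel_cond4 hq' s1111)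
    have hc := corner_lemma hq'
    have hs : ‖((Real.sqrt 2 : ℂ)⁻¹)‖ = (Real.sqrt 2)⁻¹ := by
      rw [norm_inv, Complex.norm_real, Real.norm_eq_abs, abs_of_nonneg (Real.sqrt_nonneg 2)]
    have hs0 : 0 ≤ (Real.sqrt 2)⁻¹ := by positivity
    calc ‖((Real.sqrt 2 : ℂ)⁻¹) * (star (magicMPow t) ⬝ᵥ cond4 G' s0000 + star (magicMPow t) ⬝ᵥ cond4 G' s1111)‖
        ≤ (Real.sqrt 2)⁻¹ * (‖star (magicMPow t) ⬝ᵥ cond4 G' s0000‖ + ‖star (magicMPow t) ⬝ᵥ cond4 G' s1111‖) := by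
          rw [norm_mul, hs]
          exact mul_le_mul_of_nonneg_left (norm_add_le _ _) hs0
      _ ≤ (Real.sqrt 2)⁻¹ * (((Real.sqrt 2)⁻¹) ^ t * Real.sqrt (normSq (cond4 G' s0000)) +
          ((Real.sqrt 2)⁻¹) ^ t * Real.sqrt (normSq (cond4 G' s1111))) := by gcongr
      _ = ((Real.sqrt 2)⁻¹) ^ (t + 1) * (Real.sqrt (normSq (cond4 G' s0000)) +
          Real.sqrt (normSq (cond4 G' s1111))) := by ring
      _ ≤ ((Real.sqrt 2)⁻¹) ^ (t + 1) * Real.sqrt (normSq G') :=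
          mul_le_mul_of_nonneg_left hc (by positivity)

/-- **THE GAUSSIAN FIDELITY BOUND `F_𝒢(M^{⊗t}) ≤ 2^{-t}`** (CudbyStrelchuk2023 Lemma 3, here by the
corner-lemma induction from the annihilator definition): for every Gaussian `g` on `4t` qubits,
`|⟨M^{⊗t}, g⟩|² ≤ 2^{-t} ‖g‖²`. This DISCHARGES the hypothesis `hF` of
`Negative.not_polyCoeffThesis_of_fidelityBound` and makes `Disproof.MagicPowFidelityBound` a theorem.
[cite: CudbyStrelchuk2023, Lemma 3] -/
theorem magicPowFidelityBound_holds (t : ℕ) (g : QReg (t * 4) → ℂ) (hg : IsGaussian g) :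
    ‖star (magicMPow t) ⬝ᵥ g‖ ^ 2 ≤ ((1 : ℝ) / 2) ^ t * normSq g := by
  have h := magicMPow_overlap_le t g (isGaussian_quadRel hg)
  have h2 := pow_le_pow_left₀ (norm_nonneg _) h 2
  rw [mul_pow, ← pow_mul, Real.sq_sqrt (normSq_nonneg' g)] at h2
  have hs : ((Real.sqrt 2)⁻¹) ^ (t * 2) = ((1 : ℝ) / 2) ^ t := by
    rw [mul_comm t 2, pow_mul, inv_pow, Real.sq_sqrt (by norm_num : (0 : ℝ) ≤ 2), one_div]
  rwa [hs] at h2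

/-- **The poly-coefficient strengthening of `X` is FALSE** (unconditionally): there is no `c` such that for
every `t` at most `t^c + c` UNIT Gaussian terms with coefficients of modulus `≤ t^c + c` approximate
`|M⟩^{⊗t}` to every precision — `not_polyCoeffThesis_of_fidelityBound` with its hypothesis discharged by
`magicPowFidelityBound_holds`. [cite: CudbyStrelchuk2023, Lemma 3] -/
theorem not_polyCoeffThesis :
    ¬ ∀ δ : ℝ, 0 < δ → ∃ c : ℕ, ∀ t : ℕ, ∃ r : ℕ, r ≤ t ^ c + c ∧
      ∃ (a : Fin r → ℂ) (g : Fin r → QReg (t * 4) → ℂ),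
        (∀ i, IsGaussian (g i) ∧ normSq (g i) = 1 ∧ ‖a i‖ ≤ (t : ℝ) ^ c + c) ∧
          normSq (magicMPow t - ∑ i, a i • g i) ≤ δ ^ 2 :=
  not_polyCoeffThesis_of_fidelityBound magicPowFidelityBound_holds

/-- Expansion of a squared distance: `‖ψ − φ‖² = ‖ψ‖² + ‖φ‖² − 2 Re⟨ψ, φ⟩`. [folklore] -/
theorem normSq_sub_eq {n : ℕ} (ψ φ : QReg n → ℂ) :
    normSq (ψ - φ) = normSq ψ + normSq φ - 2 * (star ψ ⬝ᵥ φ).re := by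
  have h : ((normSq (ψ - φ) : ℝ) : ℂ) = star (ψ - φ) ⬝ᵥ (ψ - φ) := (star_dotProduct_self_eq_normSq _).symm
  rw [star_sub, sub_dotProduct, dotProduct_sub, dotProduct_sub, star_dotProduct_self_eq_normSq,
    star_dotProduct_self_eq_normSq] at h
  have hconj : star φ ⬝ᵥ ψ = star (star ψ ⬝ᵥ φ) := by
    rw [star_dotProduct]
  rw [hconj] at h
  have := congrArg Complex.re h
  simp only [Complex.ofReal_re, Complex.sub_re, Complex.star_def, Complex.conj_re] at this
  linarith

/-- **ONE GAUSSIAN TERM STAYS AT SQUARED DISTANCE `≥ 1 − 2^{-t}` FROM `|M⟩^{⊗t}`** (the sharp `r = 1`,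
every-constant-`δ` case of the kill item `NegApproxGaussRankSuperpoly`): for every Gaussian `g` and scalar `a`,
`‖M^{⊗t} − a·g‖² ≥ 1 − 2^{-t}` (from `‖ψ − φ‖² ≥ 1 − 2|⟨ψ,φ⟩| + ‖φ‖² ≥ 1 − F` with `|⟨ψ,φ⟩|² ≤ F‖φ‖²`,
`F = 2^{-t}`). [cite: CudbyStrelchuk2023, Lemma 3] -/
theorem normSq_magicMPow_sub_smul_gaussian_ge (t : ℕ) (a : ℂ) (g : QReg (t * 4) → ℂ) (hg : IsGaussian g) :
    1 - ((1 : ℝ) / 2) ^ t ≤ normSq (magicMPow t - a • g) := by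
  set φ : QReg (t * 4) → ℂ := a • g with hφ
  set F : ℝ := ((1 : ℝ) / 2) ^ t with hF
  have hF0 : 0 ≤ F := by positivity
  have hψ : normSq (magicMPow t) = 1 :=
    Summit.QuantumAdvantage.QuantumAdvantage.Theorems.NegApproxGaussRankSuperpoly.Negative.normSq_magicMPow t
  -- `|⟨ψ, φ⟩|² ≤ F ‖φ‖²`
  have hov : ‖star (magicMPow t) ⬝ᵥ φ‖ ^ 2 ≤ F * normSq φ := by
    by_cases ha : a = 0
    · have : φ = 0 := by rw [hφ, ha, zero_smul]
      rw [this, dotProduct_zero, norm_zero]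
      have : 0 ≤ normSq (0 : QReg (t * 4) → ℂ) := normSq_nonneg' _
      nlinarith
    · exact magicPowFidelityBound_holds t φ (hg.smul ha)
  have hre : (star (magicMPow t) ⬝ᵥ φ).re ≤ Real.sqrt F * Real.sqrt (normSq φ) := by
    refine (Complex.re_le_norm _).trans ?_
    rw [← Real.sqrt_mul hF0, ← Real.sqrt_sq (norm_nonneg _)]
    exact Real.sqrt_le_sqrt hov
  rw [normSq_sub_eq, hψ]
  -- `1 + x² − 2√F x ≥ 1 − F` with `x = √‖φ‖²`
  have hx : normSq φ = Real.sqrt (normSq φ) ^ 2 := (Real.sq_sqrt (normSq_nonneg' φ)).symm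
  have hFsq : F = Real.sqrt F ^ 2 := (Real.sq_sqrt hF0).symm
  nlinarith [sq_nonneg (Real.sqrt (normSq φ) - Real.sqrt F), hre, hx, hFsq]

end Summit.QuantumAdvantage.QuantumAdvantage.Theorems.GaussRankPolyImpliesPPoly.Negative
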